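import Summits.QuantumFields.BalabanUV.Beta.FP.CoarseJetOrderTwoGradedCombJunctionRecordAn1Polar
import Summits.QuantumFields.BalabanUV.Beta.FP.CoarseJetOrderTwoGradedComb

/-!
# `BalabanUV.Beta.FP.CoarseJetOrderTwoGradedCombPolar` — road «FP» (binder row D1), ROUTE T, junction J4 (leaf-05): **THE DICTIONARY's ORDER-2 WORD IN THE RAW
# KKT-BLOCK CURRENCY, POLARISED AND `(k,l)`-SYMMETRISED, EQUALS THE POLARISED Θ-CURRENCY WORD** — the bilinear twin of the door's
# `CoarseJetOrderTwoGradedComb.torus_orderTwo_word_toBlocks₁₁_graded_comb` (#40b `hHG₂` books `½ • (raw(k,l).toBlocks₁₁ + raw(l,k).toBlocks₁₁)`)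

WHY.  The door translates the QUADRATIC raw word `(…L, S, I, Γ; H₁, H₂, B := [Q₁₁; 0], [Q₁₂; 0]…).toBlocks₁₁` into the Θ-currency polynomial
`P(Θ, Θᴸ, Ŝ, Γ̂; H₁, H₂, Q₁₁, Q₁₂)` for FREE jets `H₁ H₂ Q₁₁ Q₁₂`.  The (T-ID) assembly at `j = 1` (`LevelZeroLawFullIndex.hHG₂`) reads the raw word POLARISED — first jets
along `d k` ∕ `d l` on the left ∕ right first-jet slot, second jets along the pair — and symmetrised in `k ↔ l`.  Both currencies' words are exactly bilinear in the
jets, so three instances of the quadratic translation (jets `k`, `l`, `k + l` with the diagonal second jets set to `0`) give the symmetrised polarised translation: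
§1 `rawWord_add` (the raw word along a sum = the four polarised raw words), `fromRows_add_zero`, `toBlocks₁₁_add`; §2 **`torus_orderTwo_polWord_toBlocks₁₁_graded_comb`**.
With J3 `CoarseJetOrderTwoGradedCombJunctionRecordAn1Polar.torus_thetaWord_record_an1_polar` the right side is then the `(v⊗w + w⊗v)`-contracted level-`(j+1)`
table plus the displayed response sandwiches, at an1's record.  [folklore]; no `def`, no `def … : Prop`, nothing cited, 0 sorry.  Discharges NO row of the door and NO
binder of row D1.
HONEST DEPENDENCY (page 1, mandatory): continuum YM on T⁴ ⇐ BetaPertH ∧ nine spine estimates (0/9 proved); BetaPertH ⇐ (D1) ∧ (D4) ∧ CAP+tail;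
G-an2-4 gates asym, D1 and NE2/3/4.  NOT the dictionary's `hId₂`, NOT (J-a), NOT (T-ID), NOT SDF, NOT D1, NEVER «G-an2-4 closed», NOT BetaPertH, NOT continuum,
NOT Clay; 0 estimates.  «not in print; our bookkeeping».  Unit `b2b-balaban-beta-d1-formalise-leaf-05` (gen 36), 2026-08-23; no existing file touched.
-/

noncomputable section

open scoped BigOperators Matrix

namespace Summit.QuantumFields.BalabanUV.Beta.FP.CoarseJetOrderTwoGradedCombPolar

open Matrix
open Literature.Probability.LatticeModels (Torus.proj)
open Literature.MathematicalPhysics.QuantumFieldTheory.Balaban1983to89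
open Literature.MathematicalPhysics.QuantumFieldTheory.Balaban1983to89.Beta
open Literature.MathematicalPhysics.QuantumFieldTheory.Balaban1983to89.Beta.CompositionSingular (effForm flucCov minOp minOpL)
open B6Lemma24Torus (pbox)
open AffineAveraging (Site)
open AveragingContoursRooted (ctr)
open OneStepResolventKernel (Fib)
open Summit.QuantumFields.BalabanUV.Beta.AxialDressingRooted (axEc)
open Summit.QuantumFields.BalabanUV.Beta.SymShiftedSpread (bhKStepSh)
open Summit.QuantumFields.BalabanUV.Beta.DshAn1 (Dsh)
open Summit.QuantumFields.BalabanUV.Beta.CombChartStepJets (GcombSh)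
open Summit.QuantumFields.BalabanUV.Beta.FP.KernelPeriodisationFib (Idx perF)
open Summit.QuantumFields.BalabanUV.Beta.FP.TorusCombRows (Res combRowsT)
open Summit.QuantumFields.BalabanUV.Beta.FP.CoarseJetOrderTwoGradedComb (torus_orderTwo_word_toBlocks₁₁_graded_comb)
open Summit.QuantumFields.BalabanUV.Beta.FP.CoarseJetOrderTwoGradedCombJunctionRecordAn1Polar (quadWord_add)

/-! ## §1 Polarisation algebra of the raw word; `fromRows · 0` and `toBlocks₁₁` are additive -/

section Algebra

variable {ν ρ κ : Type*} [Fintype ν] [Fintype ρ]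

/-- [folklore] **THE RAW ORDER-2 WORD ALONG A SUM IS THE SUM OF THE FOUR POLARISED RAW WORDS** (`L S I Γ` the KKT blocks; first jets `Hk + Hl`, `Bk + Bl`;
second jets `Hkk + Hkl + Hlk + Hll`, `Bkk + Bkl + Blk + Bll`; `raw(k,l)` = the OWNER's #40b placement). -/
theorem rawWord_add (L : Matrix ρ ν ℝ) (S : Matrix ρ ρ ℝ) (I : Matrix ν ρ ℝ) (Γ : Matrix ν ν ℝ)
    (Hk Hl Hkk Hkl Hlk Hll : Matrix ν ν ℝ) (Bk Bl Bkk Bkl Blk Bll : Matrix ρ ν ℝ) :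
    (((-((L * (Hk + Hl) - S * (Bk + Bl)) * Γ - L * (Bk + Bl)ᵀ * L) * (Hk + Hl) + L * (Hkk + Hkl + Hlk + Hll)
          - (((L * (Hk + Hl) - S * (Bk + Bl)) * I + L * (Bk + Bl)ᵀ * S) * (Bk + Bl) + S * (Bkk + Bkl + Blk + Bll))) * I
        + (L * (Hk + Hl) - S * (Bk + Bl)) * (-((Γ * (Hk + Hl) + I * (Bk + Bl)) * I + Γ * (Bk + Bl)ᵀ * S)))
      - ((-((L * (Hk + Hl) - S * (Bk + Bl)) * Γ - L * (Bk + Bl)ᵀ * L) * (-(Bk + Bl)ᵀ) + L * (Bkk + Bkl + Blk + Bll)ᵀ) * S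
          + L * (-(Bk + Bl)ᵀ) * ((L * (Hk + Hl) - S * (Bk + Bl)) * I + L * (Bk + Bl)ᵀ * S)))
      = ((((-((L * Hk - S * Bk) * Γ - L * Bkᵀ * L) * Hk + L * Hkk
          - (((L * Hk - S * Bk) * I + L * Bkᵀ * S) * Bk + S * Bkk)) * I
        + (L * Hk - S * Bk) * (-((Γ * Hk + I * Bk) * I + Γ * Bkᵀ * S)))
      - ((-((L * Hk - S * Bk) * Γ - L * Bkᵀ * L) * (-Bkᵀ) + L * Bkkᵀ) * S
          + L * (-Bkᵀ) * ((L * Hk - S * Bk) * I + L * Bkᵀ * S))))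
      + ((((-((L * Hk - S * Bk) * Γ - L * Bkᵀ * L) * Hl + L * Hkl
          - (((L * Hk - S * Bk) * I + L * Bkᵀ * S) * Bl + S * Bkl)) * I
        + (L * Hk - S * Bk) * (-((Γ * Hl + I * Bl) * I + Γ * Blᵀ * S)))
      - ((-((L * Hk - S * Bk) * Γ - L * Bkᵀ * L) * (-Blᵀ) + L * Bklᵀ) * S
          + L * (-Bkᵀ) * ((L * Hl - S * Bl) * I + L * Blᵀ * S))))
      + ((((-((L * Hl - S * Bl) * Γ - L * Blᵀ * L) * Hk + L * Hlk
          - (((L * Hl - S * Bl) * I + L * Blᵀ * S) * Bk + S * Blk)) * I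
        + (L * Hl - S * Bl) * (-((Γ * Hk + I * Bk) * I + Γ * Bkᵀ * S)))
      - ((-((L * Hl - S * Bl) * Γ - L * Blᵀ * L) * (-Bkᵀ) + L * Blkᵀ) * S
          + L * (-Blᵀ) * ((L * Hk - S * Bk) * I + L * Bkᵀ * S))))
      + ((((-((L * Hl - S * Bl) * Γ - L * Blᵀ * L) * Hl + L * Hll
          - (((L * Hl - S * Bl) * I + L * Blᵀ * S) * Bl + S * Bll)) * I
        + (L * Hl - S * Bl) * (-((Γ * Hl + I * Bl) * I + Γ * Blᵀ * S)))
      - ((-((L * Hl - S * Bl) * Γ - L * Blᵀ * L) * (-Blᵀ) + L * Bllᵀ) * S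
          + L * (-Blᵀ) * ((L * Hl - S * Bl) * I + L * Blᵀ * S)))) := by
  simp only [Matrix.transpose_add, Matrix.mul_add, Matrix.add_mul, Matrix.mul_sub, Matrix.sub_mul, Matrix.neg_mul,
    Matrix.mul_neg, neg_add, neg_sub, Matrix.mul_assoc]
  abel

omit [Fintype ν] [Fintype ρ] in
/-- [folklore] bordered averaging jets with zero slice jet are additive in the averaging jet. -/
theorem fromRows_add_zero {μ : Type*} (Q Q' : Matrix μ ν ℝ) :
    fromRows (Q + Q') (0 : Matrix ρ ν ℝ) = fromRows Q (0 : Matrix ρ ν ℝ) + fromRows Q' (0 : Matrix ρ ν ℝ) := by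
  ext (i | i) j
  · simp only [fromRows_apply_inl, Matrix.add_apply]
  · simp only [fromRows_apply_inr, Matrix.add_apply, Matrix.zero_apply, add_zero]

omit [Fintype ρ] in
/-- [folklore] `toBlocks₁₁` is additive. -/
theorem toBlocks₁₁_add {μ : Type*} (A A' : Matrix (μ ⊕ ρ) (μ ⊕ ρ) ℝ) : (A + A').toBlocks₁₁ = A.toBlocks₁₁ + A'.toBlocks₁₁ := by
  ext i j; rfl

end Algebra

/-! ## §2 The polarised translation -/

section Polar

variable {d : ℕ} {Lc : ℕ} [NeZero Lc] (M : Fin (d + 1) → ℕ) [∀ μ, NeZero (M μ)]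

set_option synthInstance.maxSize 1024 in
set_option maxHeartbeats 800000 in
/-- **[folklore] `torus_orderTwo_polWord_toBlocks₁₁_graded_comb` — THE DICTIONARY's ORDER-2 WORD, POLARISED AND SYMMETRISED, IN Θ-CURRENCY.**  In the setting of
`torus_orderTwo_word_toBlocks₁₁_graded_comb` (binders VERBATIM: `hM`, the coarse slots `fμ hfμ hμ hcoarse`, `hH₀ hQ₁₀ hτ₁`, the KKT blocks `hΓ hI hL hS`, the torus
blocks `hΘ hΘL hŜ hΓc`), for FREE polarised jets `H₁k H₁l H₂kl H₂lk` (form) and `Q₁₁k Q₁₁l Q₁₂kl Q₁₂lk` (averaging, bordered by a zero slice jet):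
`raw(k,l).toBlocks₁₁ + raw(l,k).toBlocks₁₁ = word(k,l) + word(l,k)` — `raw` the OWNER's #40b word in `L S I Γ`, `word` its Θ-currency twin (J3's placement). -/
theorem torus_orderTwo_polWord_toBlocks₁₁_graded_comb (hM : ∀ i, Lc ∣ M i) (j : ℕ)
    {μ : Type*} [Fintype μ] [DecidableEq μ] (fμ : μ → Idx M (Fib d)) (hfμ : Function.Injective fμ)
    (hμ : ∀ a : μ, ∃ m : Fin (d + 1), (fμ a).2 = Sum.inr m)
    (hcoarse : ∀ (s : ↥(pbox M)) (m : Fin (d + 1)), ((s, Sum.inr m) : Idx M (Fib d)) ∈ Set.range fμ ↔ Torus.proj Lc (s : Site (d + 1)) = 0)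
    {H₀ : Matrix (↥(pbox M) × Fin (d + 1)) (↥(pbox M) × Fin (d + 1)) ℝ} {Q₁₀ : Matrix μ (↥(pbox M) × Fin (d + 1)) ℝ}
    {τ₁ : Matrix (Res (ctr (d + 1) Lc) Lc M) (↥(pbox M) × Fin (d + 1)) ℝ}
    (hH₀ : H₀ = (perF M (bhKStepSh d Lc (Dsh Lc) j)).submatrix
        (fun b : ↥(pbox M) × Fin (d + 1) => ((b.1, Sum.inl b.2) : Idx M (Fib d))) (fun b : ↥(pbox M) × Fin (d + 1) => ((b.1, Sum.inl b.2) : Idx M (Fib d))))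
    (hQ₁₀ : Q₁₀ = (perF M (bhKStepSh d Lc (Dsh Lc) j)).submatrix fμ (fun b : ↥(pbox M) × Fin (d + 1) => ((b.1, Sum.inl b.2) : Idx M (Fib d))))
    (hτ₁ : τ₁ = (combRowsT (ctr (d + 1) Lc) Lc M).submatrix id (fun b : ↥(pbox M) × Fin (d + 1) => ((b.1, Sum.inl b.2) : Idx M (Fib d))))
    {Γ : Matrix (↥(pbox M) × Fin (d + 1)) (↥(pbox M) × Fin (d + 1)) ℝ}
    {I : Matrix (↥(pbox M) × Fin (d + 1)) (μ ⊕ Res (ctr (d + 1) Lc) Lc M) ℝ} {L : Matrix (μ ⊕ Res (ctr (d + 1) Lc) Lc M) (↥(pbox M) × Fin (d + 1)) ℝ}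
    {S : Matrix (μ ⊕ Res (ctr (d + 1) Lc) Lc M) (μ ⊕ Res (ctr (d + 1) Lc) Lc M) ℝ}
    (hΓ : flucCov H₀ (fromRows Q₁₀ τ₁) = Γ) (hI : minOp H₀ (fromRows Q₁₀ τ₁) = I) (hL : minOpL H₀ (fromRows Q₁₀ τ₁) = L)
    (hS : effForm H₀ (fromRows Q₁₀ τ₁) = S)
    -- the four torus blocks, NAMED (VERBATIM as in `torus_orderTwo_word_toBlocks₁₁_graded_comb`)
    {Θ : Matrix (↥(pbox M) × Fin (d + 1)) μ ℝ} {ΘL : Matrix μ (↥(pbox M) × Fin (d + 1)) ℝ} {Ŝ : Matrix μ μ ℝ}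
    {Γc : Matrix (↥(pbox M) × Fin (d + 1)) (↥(pbox M) × Fin (d + 1)) ℝ}
    (hΘ : Θ = Matrix.of fun (b : ↥(pbox M) × Fin (d + 1)) (a : μ) =>
        axEc (ctr (d + 1) Lc) Lc (b.1 : Site (d + 1)) (b.1 : Site (d + 1)) (Sum.inl b.2) (Sum.inl b.2)
          * perF M (GcombSh (d := d) Lc j) (b.1, Sum.inl b.2) (fμ a))
    (hΘL : ΘL = Matrix.of fun (a : μ) (b : ↥(pbox M) × Fin (d + 1)) =>
        axEc (ctr (d + 1) Lc) Lc (b.1 : Site (d + 1)) (b.1 : Site (d + 1)) (Sum.inl b.2) (Sum.inl b.2)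
          * perF M (GcombSh (d := d) Lc j) (fμ a) (b.1, Sum.inl b.2))
    (hŜ : Ŝ = (perF M (GcombSh (d := d) Lc j)).submatrix fμ fμ)
    (hΓc : Γc = Matrix.of fun (b b' : ↥(pbox M) × Fin (d + 1)) =>
        axEc (ctr (d + 1) Lc) Lc (b.1 : Site (d + 1)) (b.1 : Site (d + 1)) (Sum.inl b.2) (Sum.inl b.2)
          * (axEc (ctr (d + 1) Lc) Lc (b'.1 : Site (d + 1)) (b'.1 : Site (d + 1)) (Sum.inl b'.2) (Sum.inl b'.2)
            * perF M (GcombSh (d := d) Lc j) (b.1, Sum.inl b.2) (b'.1, Sum.inl b'.2)))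
    (H₁k H₁l H₂kl H₂lk : Matrix (↥(pbox M) × Fin (d + 1)) (↥(pbox M) × Fin (d + 1)) ℝ) (Q₁₁k Q₁₁l Q₁₂kl Q₁₂lk : Matrix μ (↥(pbox M) × Fin (d + 1)) ℝ) :
    ((((-((L * H₁k - S * (fromRows Q₁₁k (0 : Matrix (Res (ctr (d + 1) Lc) Lc M) (↥(pbox M) × Fin (d + 1)) ℝ))) * Γ - L * (fromRows Q₁₁k (0 : Matrix (Res (ctr (d + 1) Lc) Lc M) (↥(pbox M) × Fin (d + 1)) ℝ))ᵀ * L) * H₁l + L * H₂kl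
          - (((L * H₁k - S * (fromRows Q₁₁k (0 : Matrix (Res (ctr (d + 1) Lc) Lc M) (↥(pbox M) × Fin (d + 1)) ℝ))) * I + L * (fromRows Q₁₁k (0 : Matrix (Res (ctr (d + 1) Lc) Lc M) (↥(pbox M) × Fin (d + 1)) ℝ))ᵀ * S) * (fromRows Q₁₁l (0 : Matrix (Res (ctr (d + 1) Lc) Lc M) (↥(pbox M) × Fin (d + 1)) ℝ)) + S * (fromRows Q₁₂kl (0 : Matrix (Res (ctr (d + 1) Lc) Lc M) (↥(pbox M) × Fin (d + 1)) ℝ)))) * I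
        + (L * H₁k - S * (fromRows Q₁₁k (0 : Matrix (Res (ctr (d + 1) Lc) Lc M) (↥(pbox M) × Fin (d + 1)) ℝ))) * (-((Γ * H₁l + I * (fromRows Q₁₁l (0 : Matrix (Res (ctr (d + 1) Lc) Lc M) (↥(pbox M) × Fin (d + 1)) ℝ))) * I + Γ * (fromRows Q₁₁l (0 : Matrix (Res (ctr (d + 1) Lc) Lc M) (↥(pbox M) × Fin (d + 1)) ℝ))ᵀ * S)))
      - ((-((L * H₁k - S * (fromRows Q₁₁k (0 : Matrix (Res (ctr (d + 1) Lc) Lc M) (↥(pbox M) × Fin (d + 1)) ℝ))) * Γ - L * (fromRows Q₁₁k (0 : Matrix (Res (ctr (d + 1) Lc) Lc M) (↥(pbox M) × Fin (d + 1)) ℝ))ᵀ * L) * (-(fromRows Q₁₁l (0 : Matrix (Res (ctr (d + 1) Lc) Lc M) (↥(pbox M) × Fin (d + 1)) ℝ))ᵀ) + L * (fromRows Q₁₂kl (0 : Matrix (Res (ctr (d + 1) Lc) Lc M) (↥(pbox M) × Fin (d + 1)) ℝ))ᵀ) * S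
          + L * (-(fromRows Q₁₁k (0 : Matrix (Res (ctr (d + 1) Lc) Lc M) (↥(pbox M) × Fin (d + 1)) ℝ))ᵀ) * ((L * H₁l - S * (fromRows Q₁₁l (0 : Matrix (Res (ctr (d + 1) Lc) Lc M) (↥(pbox M) × Fin (d + 1)) ℝ))) * I + L * (fromRows Q₁₁l (0 : Matrix (Res (ctr (d + 1) Lc) Lc M) (↥(pbox M) × Fin (d + 1)) ℝ))ᵀ * S)))).toBlocks₁₁
      + ((((-((L * H₁l - S * (fromRows Q₁₁l (0 : Matrix (Res (ctr (d + 1) Lc) Lc M) (↥(pbox M) × Fin (d + 1)) ℝ))) * Γ - L * (fromRows Q₁₁l (0 : Matrix (Res (ctr (d + 1) Lc) Lc M) (↥(pbox M) × Fin (d + 1)) ℝ))ᵀ * L) * H₁k + L * H₂lk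
          - (((L * H₁l - S * (fromRows Q₁₁l (0 : Matrix (Res (ctr (d + 1) Lc) Lc M) (↥(pbox M) × Fin (d + 1)) ℝ))) * I + L * (fromRows Q₁₁l (0 : Matrix (Res (ctr (d + 1) Lc) Lc M) (↥(pbox M) × Fin (d + 1)) ℝ))ᵀ * S) * (fromRows Q₁₁k (0 : Matrix (Res (ctr (d + 1) Lc) Lc M) (↥(pbox M) × Fin (d + 1)) ℝ)) + S * (fromRows Q₁₂lk (0 : Matrix (Res (ctr (d + 1) Lc) Lc M) (↥(pbox M) × Fin (d + 1)) ℝ)))) * I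
        + (L * H₁l - S * (fromRows Q₁₁l (0 : Matrix (Res (ctr (d + 1) Lc) Lc M) (↥(pbox M) × Fin (d + 1)) ℝ))) * (-((Γ * H₁k + I * (fromRows Q₁₁k (0 : Matrix (Res (ctr (d + 1) Lc) Lc M) (↥(pbox M) × Fin (d + 1)) ℝ))) * I + Γ * (fromRows Q₁₁k (0 : Matrix (Res (ctr (d + 1) Lc) Lc M) (↥(pbox M) × Fin (d + 1)) ℝ))ᵀ * S)))
      - ((-((L * H₁l - S * (fromRows Q₁₁l (0 : Matrix (Res (ctr (d + 1) Lc) Lc M) (↥(pbox M) × Fin (d + 1)) ℝ))) * Γ - L * (fromRows Q₁₁l (0 : Matrix (Res (ctr (d + 1) Lc) Lc M) (↥(pbox M) × Fin (d + 1)) ℝ))ᵀ * L) * (-(fromRows Q₁₁k (0 : Matrix (Res (ctr (d + 1) Lc) Lc M) (↥(pbox M) × Fin (d + 1)) ℝ))ᵀ) + L * (fromRows Q₁₂lk (0 : Matrix (Res (ctr (d + 1) Lc) Lc M) (↥(pbox M) × Fin (d + 1)) ℝ))ᵀ) * S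
          + L * (-(fromRows Q₁₁l (0 : Matrix (Res (ctr (d + 1) Lc) Lc M) (↥(pbox M) × Fin (d + 1)) ℝ))ᵀ) * ((L * H₁k - S * (fromRows Q₁₁k (0 : Matrix (Res (ctr (d + 1) Lc) Lc M) (↥(pbox M) × Fin (d + 1)) ℝ))) * I + L * (fromRows Q₁₁k (0 : Matrix (Res (ctr (d + 1) Lc) Lc M) (↥(pbox M) × Fin (d + 1)) ℝ))ᵀ * S)))).toBlocks₁₁
      = ((((-((-ΘL * H₁k - Ŝ * Q₁₁k) * Γc - -ΘL * Q₁₁kᵀ * -ΘL) * H₁l + -ΘL * H₂kl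
          - (((-ΘL * H₁k - Ŝ * Q₁₁k) * Θ + -ΘL * Q₁₁kᵀ * Ŝ) * Q₁₁l + Ŝ * Q₁₂kl)) * Θ
        + (-ΘL * H₁k - Ŝ * Q₁₁k) * (-((Γc * H₁l + Θ * Q₁₁l) * Θ + Γc * Q₁₁lᵀ * Ŝ)))
      - ((-((-ΘL * H₁k - Ŝ * Q₁₁k) * Γc - -ΘL * Q₁₁kᵀ * -ΘL) * (-Q₁₁lᵀ) + -ΘL * Q₁₂klᵀ) * Ŝ
          + -ΘL * (-Q₁₁kᵀ) * ((-ΘL * H₁l - Ŝ * Q₁₁l) * Θ + -ΘL * Q₁₁lᵀ * Ŝ))))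
        + ((((-((-ΘL * H₁l - Ŝ * Q₁₁l) * Γc - -ΘL * Q₁₁lᵀ * -ΘL) * H₁k + -ΘL * H₂lk
          - (((-ΘL * H₁l - Ŝ * Q₁₁l) * Θ + -ΘL * Q₁₁lᵀ * Ŝ) * Q₁₁k + Ŝ * Q₁₂lk)) * Θ
        + (-ΘL * H₁l - Ŝ * Q₁₁l) * (-((Γc * H₁k + Θ * Q₁₁k) * Θ + Γc * Q₁₁kᵀ * Ŝ)))
      - ((-((-ΘL * H₁l - Ŝ * Q₁₁l) * Γc - -ΘL * Q₁₁lᵀ * -ΘL) * (-Q₁₁kᵀ) + -ΘL * Q₁₂lkᵀ) * Ŝ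
          + -ΘL * (-Q₁₁lᵀ) * ((-ΘL * H₁k - Ŝ * Q₁₁k) * Θ + -ΘL * Q₁₁kᵀ * Ŝ)))) := by
  -- three instances of the door's quadratic translation: jets `k + l` (diagonal second jets `0`), `k`, `l`
  have Tkl := torus_orderTwo_word_toBlocks₁₁_graded_comb M hM j fμ hfμ hμ hcoarse hH₀ hQ₁₀ hτ₁ hΓ hI hL hS (H₁k + H₁l) (0 + H₂kl + H₂lk + 0)
    (Q₁₁k + Q₁₁l) (0 + Q₁₂kl + Q₁₂lk + 0) rfl hΘ hΘL hŜ hΓc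
  have Tk := torus_orderTwo_word_toBlocks₁₁_graded_comb M hM j fμ hfμ hμ hcoarse hH₀ hQ₁₀ hτ₁ hΓ hI hL hS H₁k 0 Q₁₁k 0 rfl hΘ hΘL hŜ hΓc
  have Tl := torus_orderTwo_word_toBlocks₁₁_graded_comb M hM j fμ hfμ hμ hcoarse hH₀ hQ₁₀ hτ₁ hΓ hI hL hS H₁l 0 Q₁₁l 0 rfl hΘ hΘL hŜ hΓc
  simp only [fromRows_add_zero] at Tkl
  rw [rawWord_add, quadWord_add, toBlocks₁₁_add, toBlocks₁₁_add, toBlocks₁₁_add, Tk, Tl] at Tkl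
  -- cancel the diagonal words
  have h := add_right_cancel Tkl
  rw [add_assoc, add_assoc] at h
  exact add_left_cancel h

end Polar

end Summit.QuantumFields.BalabanUV.Beta.FP.CoarseJetOrderTwoGradedCombPolar

end
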